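import Literature.AlgebraicGeometry.Resolution.AlterationsNormalFormBlowupChartsFormal
import HarnessLib

/-!
# [OURS · L1 W4.6, rungs (i)/(ii) — the dictionary, SCHEME HALF, brick 7] Over an algebraically closed field every
# closed point of `Z′` is rational over its image: germs at `ξ′` are constants plus pulled-back germs modulo `𝔪`

Cell res-hironaka (LADDER-RESOLUTION rung L, D-0089), slot W4.6, seat res-L1-s46-pv-2 (gen 2). Host: route
`WildCones`, crux `ClassicalRegimes` (stmt-ResolutionOfSingularities-16884), `--supports … --as helper`.

HONEST FRAMING. Everything here is OURS: scheme bookkeeping over the tree's constants machinery for schemes locally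
of finite type over an algebraically closed field (`sectionConst`, `exists_sub_germ_sectionConst_mem_maximalIdeal_
of_isClosed` — Zariski's lemma —, `appLE_sectionConst`, `stalkMap_germ_appLE`, file
`Literature/AlgebraicGeometry/Resolution/AlterationsNormalFormBlowupChartsFormal.lean`). NOTHING here is a statement
of H. Hironaka's manuscript [Hironaka2017]; no FACT-LIST premise. AI review is weaker than expert review.

## Statement (`exists_sub_stalkMap_mem_maximalIdeal_of_isClosed`)

For a morphism `π : Z′ → Z` of schemes over `Spec k`, `k` algebraically closed, `Z′` locally of finite type over `k`,
and a CLOSED point `ξ′ ∈ Z′`: every germ `y ∈ 𝒪_{Z′,ξ′}` is congruent modulo `𝔪_{ξ′}` to `π^♯(r)` for some germ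
`r ∈ 𝒪_{Z,π ξ′}` (namely a constant). This is the rationality hypothesis `hrat` of brick 6
(`ChartPoint.exists_stalk_chartData`, `Theorems/WildConesCampaignW46StalkChart.lean`) — so over an algebraically
closed ground field (the first case of the forced-regime rung) bricks 5–6 apply at EVERY closed point of the
blow-up.

References: The Stacks Project, Tag 0CY7 (closed points and Zariski's lemma); H. Hironaka, ms. 2017, Th. 16.6 p.84
— ROLE of «the closed point `ξ′ ∈ π⁻¹(ξ)`» only, under adjudication, not cited as fact. [StacksProject] [folklore]
-/

noncomputable section

-- single-problem summit: the doubled namespace component `ResolutionOfSingularities` is forced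
set_option linter.dupNamespace false

open CategoryTheory AlgebraicGeometry TopologicalSpace IsLocalRing

namespace Summit.ResolutionOfSingularities.ResolutionOfSingularities.Theorems

namespace CampaignW46.ChartPoint

open Literature.AlgebraicGeometry.Resolution

universe u

/-- [OURS · L1 W4.6 — DICTIONARY, SCHEME HALF, brick 7; NOT a statement of the manuscript] **Closed points over an
algebraically closed field are rational over their images**: for `π : Z′ → Z` over `Spec k` (`k` algebraically
closed, `Z′` locally of finite type over `k`) and a closed point `ξ′`, every germ at `ξ′` is `π^♯` of a germ at
`π ξ′` modulo `𝔪_{ξ′}`. [cite: StacksProject, Tag 0CY7] [folklore] -/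
theorem exists_sub_stalkMap_mem_maximalIdeal_of_isClosed {k : Type u} [Field k] [IsAlgClosed k]
    {Z Z' : Scheme.{u}} (π : Z' ⟶ Z) (q : Z ⟶ Spec (.of k)) [LocallyOfFiniteType (π ≫ q)]
    (ξ' : Z') (hξ' : IsClosed ({ξ'} : Set Z')) (y : Z'.presheaf.stalk ξ') :
    ∃ r : Z.presheaf.stalk (π ξ'), y - (π.stalkMap ξ').hom r ∈ maximalIdeal (Z'.presheaf.stalk ξ') := by
  -- affine neighbourhoods `V ∋ ξ′`, `U ∋ π ξ′` with `V ⊆ π⁻¹ U`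
  obtain ⟨U, hU, hxU, -⟩ := exists_isAffineOpen_mem_and_subset (X := Z) (x := π ξ') (U := ⊤) trivial
  obtain ⟨V, hV, hxV, hVU⟩ := exists_isAffineOpen_mem_and_subset (X := Z') (x := ξ') (U := π ⁻¹ᵁ U) hxU
  have hVU' : V ≤ π ⁻¹ᵁ U := hVU
  -- `y ≡` a constant on `V`, and constants are pulled back from `U`
  obtain ⟨l, hl⟩ := exists_sub_germ_sectionConst_mem_maximalIdeal_of_isClosed (π ≫ q) hV hxV hξ' y
  refine ⟨(Z.presheaf.germ U (π ξ') hxU).hom (sectionConst q U l), ?_⟩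
  rwa [stalkMap_germ_appLE π hVU' hxV, appLE_sectionConst]

end CampaignW46.ChartPoint

end Summit.ResolutionOfSingularities.ResolutionOfSingularities.Theorems

end
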